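import Summits.ResolutionOfSingularities.ResolutionOfSingularities.Theorems.WeightedInvariantE2CentreSchemeGlue
import Summits.ResolutionOfSingularities.ResolutionOfSingularities.Theorems.WeightedInvariantELadderTwoMaxClosed
import HarnessLib

/-!
# E2 centre, word (G-6b) `e2CentreHom`: EVERY stalkwise-maximal canonical e = 2 centre IS the glued local model — a finite cover of
# `closure (maxLocus₂)` by model charts `D(t ℓ)` on which `Rₙ(D(t ℓ)) = 𝒥ₙ(U ℓ, w ℓ)·Γ(D(t ℓ))` (step 2 of the local-model route to «(a″)»)

Route `ResolutionOfSingularities/WeightedInvariant`, crux `Theses.WeightedInvariant.HypersurfaceCentreConstruction`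
(stmt-ResolutionOfSingularities-19897), door line `local-engine` (skeleton v3.12), E2 tier, registered stub `stub_e2_centre_h`, word (G-6b), status
`Cruxes/HypersurfaceCentreConstruction/G6B-LEMMA-H-STATUS.md`: after …E2CentreHomOfNoEmbedded the word rests on «(a″)» «`Rₙ(W)` has no embedded
associated points» for an ARBITRARY canonical e = 2 centre `R` that is stalkwise maximal (the quantifier of `E2CentreHomBody`).  The tree's scheme glue
(res-D-pv-048, `e2CentreSchemeGlue`) BUILDS such a centre from a finite family of model charts with the chartwise description
`(R⁰ₙ)(D(t ℓ)) = 𝒥ₙ(U ℓ, w ℓ)·Γ(D(t ℓ))` (`Stage.exists_isCanonicalCentre₂_of_modelCharts`); by the UNIQUENESS seam `piece_eq_of_maximal` every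
stalkwise-maximal canonical centre has the same pieces.  This file records the consequence:
* `Stage.exists_modelCover_piece_ideal_eq` — under the graded HOM rung, (I0)₂ and (G-0) `E2HomogeneousChartBody`, for every canonical e = 2 centre `R`
  that is stalkwise maximal there is a FINITE family of model charts (unit charts `a ℓ`, homogeneous `t ℓ`, `N ℓ ≤ 3` homogeneous parameters `U ℓ`
  with positive weights `w ℓ`, the (S5)/(S6)/(S3) clauses on `D(t ℓ)`) covering `closure (maxLocus₂)` with
  `(R.piece m).ideal (D(t ℓ)) = 𝒥ₘ(U ℓ, w ℓ)·Γ(D(t ℓ))` for all `ℓ`, `m`.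
With …E2ModelChartCover / `E2Model.associatedPrimes_quotient_subset_minimalPrimes` (…E2ModelPrimary, `hloc` from `Stage.hloc_basicOpen`) and
`Stage.exists_mem_maxLocus₂_specializes_of_mem_minimalPrimes`, what then remains of «(a″)» is only the INTRINSICNESS of associated points (an
associated prime of `Γ(W) ⧸ Rₙ(W)` at `ξ ∈ D(t ℓ)` is one of `Γ(D(t ℓ)) ⧸ Rₙ(D(t ℓ))`: Mathlib
`Module.associatedPrimes.preimage_comap_associatedPrimes_eq_associatedPrimes_of_isLocalizedModule` through the stalk `𝒪_{Y,ξ}`).  Def-free helper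
(`--supports stmt-ResolutionOfSingularities-19897`); nothing here asserts any clause or anything about resolution of singularities in characteristic `p`;
AI-written, weaker than expert review. [OURS · L1 W4.3]
-/

noncomputable section

set_option linter.dupNamespace false -- mandated namespace of this single-conjunct summit
set_option backward.isDefEq.respectTransparency false

open CategoryTheory AlgebraicGeometry TopologicalSpace IsLocalRing Topology
open Literature.AlgebraicGeometry.Resolution
open Summit.ResolutionOfSingularities.ResolutionOfSingularities.Theorems
open Summit.ResolutionOfSingularities.ResolutionOfSingularities.Theorems.ELadderOne
open Summit.ResolutionOfSingularities.ResolutionOfSingularities.Cruxes.HypersurfaceCentreConstruction.LocalEngine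

namespace Summit.ResolutionOfSingularities.ResolutionOfSingularities.Theorems.ELadderOne.Stage

variable {k : Type} [Field k] (S : Stage k) {p : ℕ} (ι : (R : Type) → [CommRing R] → R → Ordinal.{0})
  (J : (R : Type) → [CommRing R] → R → ℕ → Ideal R)

/-- **Every stalkwise-maximal canonical e = 2 centre is the glued local model** (see the module docstring): a finite family of model charts covering
`closure (maxLocus₂)` on which the pieces of `R` are the weighted monomial ideals. [folklore] -/
theorem exists_modelCover_piece_ideal_eq [CharP k p] [PerfectField k] (hr : PRungGrHomLE 3 p ι J) (h0 : S.InvDim₂)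
    (hG0 : E2HomogeneousChartBody p ι J) {R : ReesAlgebraData S.Y} (hR : S.IsCanonicalCentre₂ ι J R)
    (hmaxR : ∀ (n : ℕ) (K : S.Y.IdealSheafData),
      (∀ η ∈ S.maxLocus₂ ι, stalkIdeal K η ≤ J (S.Y.presheaf.stalk η) (localGenerator S.i.ker η) n) → K ≤ R.piece n) :
    ∃ (L : Type) (_ : Fintype L) (a : L → S.atlas.ι) (t : ∀ ℓ, Γ(S.Y, S.atlas.W (a ℓ))) (N : L → ℕ)
      (U : ∀ ℓ, Fin (N ℓ) → Γ(S.Y, S.atlas.W (a ℓ))) (w : ∀ ℓ, Fin (N ℓ) → ℕ),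
      (∀ ℓ, S.IsUnitChart (a ℓ)) ∧ (∀ ℓ, N ℓ ≤ 3) ∧ (∀ ℓ i, 0 < w ℓ i) ∧
      (∀ ℓ, letI := S.atlas.gradedRing (a ℓ); ∀ i, SetLike.IsHomogeneousElem (S.atlas.piece (a ℓ)) (U ℓ i)) ∧
      closure (S.maxLocus₂ ι) ⊆ ⋃ ℓ, (S.Y.basicOpen (t ℓ) : Set S.Y) ∧
      (∀ ℓ (y : S.Y) (hy : y ∈ S.Y.basicOpen (t ℓ)), ringKrullDim (S.Y.presheaf.stalk y) ≤ ((3 : ℕ) : WithBot ℕ∞) →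
        (∀ i, (S.Y.presheaf.germ (S.atlas.W (a ℓ)) y (S.Y.basicOpen_le (t ℓ) hy)).hom (U ℓ i) ∈ maximalIdeal (S.Y.presheaf.stalk y)) →
        ∀ m : ℕ, J (S.Y.presheaf.stalk y) (localGenerator S.i.ker y) m =
          (weightedMonomialIdeal (U ℓ) (w ℓ) m).map (S.Y.presheaf.germ (S.atlas.W (a ℓ)) y (S.Y.basicOpen_le (t ℓ) hy)).hom) ∧
      (∀ ℓ (y : S.Y) (hy : y ∈ S.Y.basicOpen (t ℓ)), ringKrullDim (S.Y.presheaf.stalk y) ≤ ((3 : ℕ) : WithBot ℕ∞) →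
        ((∀ i, (S.Y.presheaf.germ (S.atlas.W (a ℓ)) y (S.Y.basicOpen_le (t ℓ) hy)).hom (U ℓ i) ∈ maximalIdeal (S.Y.presheaf.stalk y)) ↔
          (y ∈ singImage S.i.ker ∧ iotaAt ι S.i.ker y = S.mu₂ ι))) ∧
      (∀ ℓ (y : S.Y) (hy : y ∈ S.Y.basicOpen (t ℓ))
        (hU : ∀ i, (S.Y.presheaf.germ (S.atlas.W (a ℓ)) y (S.Y.basicOpen_le (t ℓ) hy)).hom (U ℓ i) ∈ maximalIdeal (S.Y.presheaf.stalk y)),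
        LinearIndependent (ResidueField (S.Y.presheaf.stalk y))
          (fun i => (maximalIdeal (S.Y.presheaf.stalk y)).toCotangent ⟨_, hU i⟩)) ∧
      ∀ ℓ (m : ℕ), (R.piece m).ideal (S.Y.affineBasicOpen (t ℓ)) =
        (weightedMonomialIdeal (U ℓ) (w ℓ) m).map (S.Y.presheaf.map (homOfLE (S.Y.basicOpen_le (t ℓ))).op).hom := by
  classical
  haveI : JacobsonSpace S.Y := LocallyOfFiniteType.jacobsonSpace S.f
  haveI : NoetherianSpace S.Y := S.noetherianSpace
  have hcb : ∀ y ∈ S.genSing₂, y ∈ closure (S.maxLocus₂ ι) → y ∈ S.maxLocus₂ ι :=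
    fun y hy hcl => S.mem_maxLocus₂_of_mem_closure ι J hr h0 hy hcl
  set M : Set S.Y := closure (S.maxLocus₂ ι) with hM
  -- (G-1): a model chart through every closed point of `M` (verbatim from `e2CentreSchemeGlue`)
  have hdata : ∀ c : {c : S.Y // IsClosed ({c} : Set S.Y) ∧ c ∈ M},
      ∃ (a : S.atlas.ι) (N : ℕ) (t : Γ(S.Y, S.atlas.W a)) (U : Fin N → Γ(S.Y, S.atlas.W a)) (w : Fin N → ℕ),
        S.IsUnitChart a ∧ c.1 ∈ S.Y.basicOpen t ∧ N ≤ 3 ∧ (∀ i, 0 < w i) ∧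
        (letI := S.atlas.gradedRing a; ∀ i, SetLike.IsHomogeneousElem (S.atlas.piece a) (U i)) ∧
        (∀ (y : S.Y) (hy : y ∈ S.Y.basicOpen t), ringKrullDim (S.Y.presheaf.stalk y) ≤ ((3 : ℕ) : WithBot ℕ∞) →
          (∀ i, (S.Y.presheaf.germ (S.atlas.W a) y (S.Y.basicOpen_le t hy)).hom (U i) ∈ maximalIdeal (S.Y.presheaf.stalk y)) →
          ∀ m : ℕ, J (S.Y.presheaf.stalk y) (localGenerator S.i.ker y) m =
            (weightedMonomialIdeal U w m).map (S.Y.presheaf.germ (S.atlas.W a) y (S.Y.basicOpen_le t hy)).hom) ∧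
        (∀ (y : S.Y) (hy : y ∈ S.Y.basicOpen t), ringKrullDim (S.Y.presheaf.stalk y) ≤ ((3 : ℕ) : WithBot ℕ∞) →
          ((∀ i, (S.Y.presheaf.germ (S.atlas.W a) y (S.Y.basicOpen_le t hy)).hom (U i) ∈ maximalIdeal (S.Y.presheaf.stalk y)) ↔
            (y ∈ singImage S.i.ker ∧ iotaAt ι S.i.ker y = S.mu₂ ι))) ∧
        (∀ (y : S.Y) (hy : y ∈ S.Y.basicOpen t)
          (hU : ∀ i, (S.Y.presheaf.germ (S.atlas.W a) y (S.Y.basicOpen_le t hy)).hom (U i) ∈ maximalIdeal (S.Y.presheaf.stalk y)),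
          LinearIndependent (ResidueField (S.Y.presheaf.stalk y))
            (fun i => (maximalIdeal (S.Y.presheaf.stalk y)).toCotangent ⟨_, hU i⟩)) := by
    rintro ⟨c, hcc, hcM⟩
    obtain ⟨x, rfl⟩ := Stage.mem_range_of_mem_singImage S (S.closure_maxLocus₂_subset_singImage ι hcM)
    obtain ⟨a, hca, ha⟩ := S.exists_isUnitChart x
    obtain ⟨η, hηa, hηm, hcore⟩ := S.exists_mem_maxLocus₂_primeIdealOf_eq_homogeneousCore ι h0 hcb ha hca hcc hcM
    obtain ⟨δ, t, N, U, w, htδ, htη, hN, hw, hUhom, hS5, hS6, hS3⟩ := S.exists_e2ModelChartAt ι J hr hG0 hηm ha hηa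
    exact ⟨a, N, t, U, w, ha, S.mem_basicOpen_of_primeIdealOf_eq_homogeneousCore hca hηa hcore htδ htη, hN, hw, hUhom,
      hS5, hS6, hS3⟩
  choose a N t U w ha hct hN hw hUhom hS5 hS6 hS3 using hdata
  have hZ : ∀ (c) (y : S.Y) (hy : y ∈ S.Y.basicOpen (t c)),
      (∀ i, (S.Y.presheaf.germ (S.atlas.W (a c)) y (S.Y.basicOpen_le (t c) hy)).hom (U c i) ∈ maximalIdeal (S.Y.presheaf.stalk y)) →
      y ∈ closure (S.maxLocus₂ ι) := fun c y hy hUy =>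
    S.mem_closure_maxLocus₂_of_forall_germ_mem ι h0 (ha c) (hN c) (t c) (U c) (hUhom c) (hS6 c) hy hUy
  have hMz : ∀ (c) (y : S.Y) (hy : y ∈ S.Y.basicOpen (t c)), y ∈ closure (S.maxLocus₂ ι) →
      ∀ i, (S.Y.presheaf.germ (S.atlas.W (a c)) y (S.Y.basicOpen_le (t c) hy)).hom (U c i) ∈ maximalIdeal (S.Y.presheaf.stalk y) :=
    fun c y hy hyM => S.forall_germ_mem_of_mem_closure_maxLocus₂ ι (t c) (U c) (hS6 c) hy hyM
  -- finitely many charts cover `M`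
  have hcovM : M ⊆ ⋃ c, (S.Y.basicOpen (t c) : Set S.Y) := by
    intro y hyM
    by_contra hyV
    have hne : (M ∩ (⋃ c, (S.Y.basicOpen (t c) : Set S.Y))ᶜ).Nonempty := ⟨y, hyM, hyV⟩
    have hlc : IsLocallyClosed (M ∩ (⋃ c, (S.Y.basicOpen (t c) : Set S.Y))ᶜ) :=
      (isClosed_closure.inter (isOpen_iUnion fun c => (S.Y.basicOpen (t c)).2).isClosed_compl).isLocallyClosed
    obtain ⟨c₀, ⟨hc₀M, hc₀V⟩, hc₀c⟩ := nonempty_inter_closedPoints hne hlc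
    exact hc₀V (Set.mem_iUnion.mpr ⟨⟨c₀, mem_closedPoints_iff.mp hc₀c, hc₀M⟩, hct _⟩)
  obtain ⟨F, hF⟩ := (NoetherianSpace.isCompact M).elim_finite_subcover (fun c => (S.Y.basicOpen (t c) : Set S.Y))
    (fun c => (S.Y.basicOpen (t c)).2) hcovM
  have hcovF : closure (S.maxLocus₂ ι) ⊆ ⋃ ℓ : {c // c ∈ F}, (S.Y.basicOpen (t ℓ.1) : Set S.Y) := by
    intro y hy
    obtain ⟨c, hcF, hyc⟩ := Set.mem_iUnion₂.mp (hF hy)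
    exact Set.mem_iUnion.mpr ⟨⟨c, hcF⟩, hyc⟩
  -- F2b: glue the finite family of model charts to the centre `R⁰` with its chartwise description and chartwise maximality
  obtain ⟨R₀, hcan, -, -, hmodel, hmaxC⟩ := S.exists_isCanonicalCentre₂_of_modelCharts ι J (L := {c // c ∈ F})
    (fun ℓ => a ℓ.1) (fun ℓ => t ℓ.1) (fun ℓ => N ℓ.1) (fun ℓ => U ℓ.1) (fun ℓ => w ℓ.1) (fun ℓ => hw ℓ.1) hcovF
    (fun ℓ ℓ' m y hy hy' => le_antisymm
      (S.map_weightedMonomialIdeal_germ_le_of_charts ι J (hN ℓ'.1) (t ℓ'.1) (U ℓ'.1) (w ℓ'.1) (hw ℓ'.1) (hS5 ℓ'.1) (hS3 ℓ'.1)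
        (hZ ℓ'.1) (t ℓ.1) (U ℓ.1) (w ℓ.1) (hS5 ℓ.1) (hMz ℓ.1) hy' hy m)
      (S.map_weightedMonomialIdeal_germ_le_of_charts ι J (hN ℓ.1) (t ℓ.1) (U ℓ.1) (w ℓ.1) (hw ℓ.1) (hS5 ℓ.1) (hS3 ℓ.1)
        (hZ ℓ.1) (t ℓ'.1) (U ℓ'.1) (w ℓ'.1) (hS5 ℓ'.1) (hMz ℓ'.1) hy hy' m))
    (fun ℓ η hηm hη m => (hS5 ℓ.1 η hη hηm.1.2.2 ((hS6 ℓ.1 η hη hηm.1.2.2).mpr ⟨hηm.1.1, hηm.2⟩) m).symm)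
    (fun ℓ y hy hUy => hZ ℓ.1 y hy hUy)
    (fun ℓ η hηm hη i => ((hS6 ℓ.1 η hη hηm.1.2.2).mpr ⟨hηm.1.1, hηm.2⟩) i)
    (fun ℓ y hy hU => hS3 ℓ.1 y hy hU)
  -- stalkwise maximality of `R⁰`, hence `R = R⁰` piecewise (uniqueness seam)
  have hmax₀ : ∀ (n : ℕ) (K : S.Y.IdealSheafData),
      (∀ η ∈ S.maxLocus₂ ι, stalkIdeal K η ≤ J (S.Y.presheaf.stalk η) (localGenerator S.i.ker η) n) → K ≤ R₀.piece n :=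
    fun n K hK => hmaxC n K fun ℓ =>
      S.ideal_basicOpen_le_of_forall_stalkIdeal_le ι J (t ℓ.1) (U ℓ.1) (w ℓ.1) (hw ℓ.1) (hS5 ℓ.1) (hS3 ℓ.1) (hZ ℓ.1) (hMz ℓ.1)
        K hK
  have hRR₀ : ∀ m, R.piece m = R₀.piece m := fun m => piece_eq_of_maximal ι J S hR hcan hmaxR hmax₀ m
  refine ⟨{c // c ∈ F}, inferInstance, fun ℓ => a ℓ.1, fun ℓ => t ℓ.1, fun ℓ => N ℓ.1, fun ℓ => U ℓ.1, fun ℓ => w ℓ.1,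
    fun ℓ => ha ℓ.1, fun ℓ => hN ℓ.1, fun ℓ => hw ℓ.1, fun ℓ => hUhom ℓ.1, hcovF, fun ℓ => hS5 ℓ.1, fun ℓ => hS6 ℓ.1,
    fun ℓ => hS3 ℓ.1, fun ℓ m => ?_⟩
  rw [hRR₀ m]
  exact hmodel ℓ m

end Summit.ResolutionOfSingularities.ResolutionOfSingularities.Theorems.ELadderOne.Stage

end
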